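import Literature.AlgebraicGeometry.Motives.WeilTypeSignature
import Literature.AlgebraicGeometry.Motives.WeilDiscriminant
import HarnessLib

/-!
# Unitary frames exist: Sylvester's law of inertia for Hermitian forms over `ℂ`

For a finite-dimensional complex vector space `V` and a NON-DEGENERATE Hermitian form `H`
(sesquilinear `V →ₗ⋆[ℂ] V →ₗ[ℂ] ℂ`, `LinearMap.IsSymm`), there are `p + q = dim V` and an
isometry of `(V, H)` with the standard space `(ℂᵖ × ℂ^q, ⟪·,·⟫ ⊖ ⟪·,·⟫)` — a UNITARY FRAME in the
sense of `Motives/WeilTypeSignature` (`exists_unitaryFrame_of_nondegenerate`); the signature `(p, q)` is unique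
(`UnitaryFrame.signature_unique`). Proof (Gohberg–Lancaster–Rodman, *Indefinite Linear Algebra*,
Thm. A.1.1 / (2.3.8) "there exists an invertible `S` with `S^*HS = diag(1, …, 1, -1, …, -1)`";
Lang, *Algebra*, XV §5): diagonalise the Gram matrix `G = (H(bᵢ, bⱼ))` of a basis by the spectral
theorem (`Matrix.IsHermitian.eigenvectorBasis`): the vectors `vⱼ = Σₖ uⱼₖ bₖ` built from an
orthonormal eigenbasis `(uⱼ)` of `G` are `H`-orthogonal with `H(vⱼ, vⱼ) = λⱼ` (`apply_hermitianEigVec`) and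
form a basis; non-degeneracy forces `λⱼ ≠ 0` (`eigenvalues_ne_zero`); rescaling by `|λⱼ|^{-1/2}`
and sorting the indices by the sign of `λⱼ` gives a signed orthonormal basis indexed by
`Fin p ⊕ Fin q`, whence the frame (`UnitaryFrame.ofSignedBasis`).

Consequences for the period domain of the Weil family (Deligne LNM 900 p. 49; van Geemen LNM 1594
5.5–5.10): for EVERY non-degenerate Hermitian `(V, H)` the set `X⁺` of complex structures of Weil
type is non-empty and in bijection with the type AIII ball `unitaryPeriodDomain p q`
(`exists_weilComplexStructureEquiv_unitaryPeriodDomain`).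

Everything is proved; no named fact is introduced.

## References

* [GohbergLancasterRodman2005] I. Gohberg, P. Lancaster, L. Rodman, *Indefinite Linear Algebra
  and Applications* (2005), §2.3 Thm. 2.3.2 and (2.3.8), Appendix Thm. A.1.1.
* [vanGeemen1994HodgeAV] B. van Geemen, LNM 1594, 5.4 (normal form of `H`), 5.5–5.10.
* [Deligne1982HodgeCycles] P. Deligne, LNM 900, proof of Thm. 4.8, p. 49.
-/

noncomputable section

open Module
open scoped ComplexConjugate InnerProductSpace

namespace Literature.AlgebraicGeometry.Motives

variable {V : Type*} [AddCommGroup V] [Module ℂ V] {H : V →ₗ⋆[ℂ] V →ₗ[ℂ] ℂ}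

/-! ### Sesquilinear expansion in a family -/

section Expansion

variable {ι : Type*} [Fintype ι]

/-- `H(Σ fᵢ bᵢ, Σ gⱼ bⱼ) = Σᵢ Σⱼ f̄ᵢ gⱼ H(bᵢ, bⱼ)`. [folklore] -/
theorem sesq_apply_sum_smul_sum_smul (H : V →ₗ⋆[ℂ] V →ₗ[ℂ] ℂ) (b : ι → V) (f g : ι → ℂ) :
    H (∑ i, f i • b i) (∑ j, g j • b j) = ∑ i, ∑ j, conj (f i) * g j * H (b i) (b j) := by
  simp only [map_sum, map_smulₛₗ, LinearMap.sum_apply, LinearMap.smul_apply, smul_eq_mul,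
    RingHom.id_apply, Finset.mul_sum]
  rw [Finset.sum_comm]
  refine Finset.sum_congr rfl fun i _ => Finset.sum_congr rfl fun j _ => ?_
  ring

/-- … for an `H`-orthogonal family with `H(bᵢ, bⱼ) = δᵢⱼ dᵢ`: `H(Σ fᵢ bᵢ, Σ gᵢ bᵢ) = Σᵢ f̄ᵢ gᵢ dᵢ`.
[folklore] -/
theorem sesq_apply_sum_smul_of_orthogonal [DecidableEq ι] (H : V →ₗ⋆[ℂ] V →ₗ[ℂ] ℂ) {b : ι → V}
    {d : ι → ℂ} (hb : ∀ i j, H (b i) (b j) = if i = j then d i else 0) (f g : ι → ℂ) :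
    H (∑ i, f i • b i) (∑ j, g j • b j) = ∑ i, conj (f i) * g i * d i := by
  rw [sesq_apply_sum_smul_sum_smul]
  refine Finset.sum_congr rfl fun i _ => ?_
  simp_rw [hb i, mul_ite, mul_zero]
  rw [Finset.sum_ite_eq]
  simp

/-- An `H`-orthogonal family with non-zero squares is linearly independent. [folklore] -/
theorem linearIndependent_of_sesq_orthogonal [DecidableEq ι] (H : V →ₗ⋆[ℂ] V →ₗ[ℂ] ℂ) {b : ι → V}
    {d : ι → ℂ} (hb : ∀ i j, H (b i) (b j) = if i = j then d i else 0) (hd : ∀ i, d i ≠ 0) :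
    LinearIndependent ℂ b := by
  rw [Fintype.linearIndependent_iff]
  intro g hg i
  have h := congrArg (H (b i)) hg
  rw [map_zero, show b i = ∑ j, (Pi.single i (1 : ℂ) : ι → ℂ) j • b j by
    simp [Pi.single_apply], sesq_apply_sum_smul_of_orthogonal H hb] at h
  simp only [Pi.single_apply] at h
  rw [Finset.sum_eq_single i (fun j _ hji => by simp [hji]) (by simp)] at h
  simp only [if_true, map_one, one_mul, mul_eq_zero] at h
  exact h.resolve_right (hd i)

end Expansion

/-! ### Diagonalising the Gram matrix -/

section Gram

variable {ι : Type*}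

/-- The Gram matrix `(H(bᵢ, bⱼ))` (`Motives/WeilDiscriminant.gramMatrix`) of a Hermitian form is
Hermitian. [cite: GohbergLancasterRodman2005, §2.2] -/
theorem isHermitian_gramMatrix (hH : H.IsSymm) (b : ι → V) :
    (gramMatrix (fun x y => H x y) b).IsHermitian := by
  ext i j
  simp only [Matrix.conjTranspose_apply, gramMatrix_apply, Complex.star_def, hH.eq]

variable [Fintype ι] [DecidableEq ι] (hH : H.IsSymm) (b : Basis ι ℂ V)

/-- The vectors `vⱼ = Σₖ uⱼₖ bₖ` of an orthonormal eigenbasis `(uⱼ)` of the Gram matrix.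
[cite: GohbergLancasterRodman2005, §2.3 (2.3.8) and Thm. A.1.1] -/
def hermitianEigVec (j : ι) : V :=
  ∑ k, ((isHermitian_gramMatrix hH b).eigenvectorBasis j).ofLp k • b k

/-- **The `vⱼ` diagonalise `H`**: `H(vᵢ, vⱼ) = δᵢⱼ λⱼ` with the (real) eigenvalues `λⱼ` of the Gram
matrix. [cite: GohbergLancasterRodman2005, §2.3 (2.3.8) and Thm. A.1.1] -/
theorem apply_hermitianEigVec (i j : ι) :
    H (hermitianEigVec hH b i) (hermitianEigVec hH b j) =
      if i = j then ((isHermitian_gramMatrix hH b).eigenvalues i : ℂ) else 0 := by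
  set hG := isHermitian_gramMatrix hH b
  have hmv : ∀ k, ∑ l, (hG.eigenvectorBasis j).ofLp l * H (b k) (b l) =
      (hG.eigenvalues j : ℂ) * (hG.eigenvectorBasis j).ofLp k := by
    intro k
    have h := congrFun (hG.mulVec_eigenvectorBasis j) k
    simp only [Matrix.mulVec, dotProduct, gramMatrix_apply, Pi.smul_apply, Complex.real_smul] at h
    rw [← h]
    exact Finset.sum_congr rfl fun l _ => mul_comm _ _
  have horth : ∑ k, conj ((hG.eigenvectorBasis i).ofLp k) * (hG.eigenvectorBasis j).ofLp k =
      if i = j then 1 else 0 := by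
    have h := (orthonormal_iff_ite.1 hG.eigenvectorBasis.orthonormal) i j
    rw [EuclideanSpace.inner_eq_star_dotProduct] at h
    rw [← h, dotProduct]
    exact Finset.sum_congr rfl fun k _ => by rw [Pi.star_apply, Complex.star_def, mul_comm]
  rw [hermitianEigVec, hermitianEigVec, sesq_apply_sum_smul_sum_smul]
  calc ∑ k, ∑ l, conj ((hG.eigenvectorBasis i).ofLp k) * (hG.eigenvectorBasis j).ofLp l *
          H (b k) (b l)
        = ∑ k, conj ((hG.eigenvectorBasis i).ofLp k) *
            ((hG.eigenvalues j : ℂ) * (hG.eigenvectorBasis j).ofLp k) := by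
          refine Finset.sum_congr rfl fun k _ => ?_
          rw [← hmv k, Finset.mul_sum]
          exact Finset.sum_congr rfl fun l _ => by ring
    _ = (hG.eigenvalues j : ℂ) *
          ∑ k, conj ((hG.eigenvectorBasis i).ofLp k) * (hG.eigenvectorBasis j).ofLp k := by
          rw [Finset.mul_sum]
          exact Finset.sum_congr rfl fun k _ => by ring
    _ = if i = j then ((isHermitian_gramMatrix hH b).eigenvalues i : ℂ) else 0 := by
          rw [horth]
          split_ifs with hij
          · subst hij
            simp
          · simp

/-- The `vⱼ` are linearly independent (the eigenbasis matrix is invertible).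
[cite: GohbergLancasterRodman2005, Thm. A.1.1] -/
theorem linearIndependent_hermitianEigVec : LinearIndependent ℂ (hermitianEigVec hH b) := by
  set hG := isHermitian_gramMatrix hH b
  rw [Fintype.linearIndependent_iff]
  intro g hg i
  -- coefficients of `bₖ` vanish
  have hsum : ∑ k, (∑ i', g i' * (hG.eigenvectorBasis i').ofLp k) • b k = 0 := by
    rw [← hg]
    simp_rw [hermitianEigVec, Finset.smul_sum, smul_smul, Finset.sum_smul]
    exact Finset.sum_comm
  have hcoef : ∀ k, ∑ i', g i' * (hG.eigenvectorBasis i').ofLp k = 0 :=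
    Fintype.linearIndependent_iff.1 b.linearIndependent _ hsum
  -- hence `Σ gᵢ uᵢ = 0` in `ℂ^ι`, and the `uᵢ` are independent
  have hU : ∑ i', g i' • (hG.eigenvectorBasis i' : EuclideanSpace ℂ ι) = 0 := by
    ext k
    rw [WithLp.ofLp_sum, Finset.sum_apply]
    simpa [WithLp.ofLp_smul] using hcoef k
  have hli := hG.eigenvectorBasis.toBasis.linearIndependent
  rw [OrthonormalBasis.coe_toBasis, Fintype.linearIndependent_iff] at hli
  exact hli g hU i

variable [FiniteDimensional ℂ V]

/-- The basis `(vⱼ)`. [cite: GohbergLancasterRodman2005, Thm. A.1.1] -/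
def hermitianEigVecBasis : Basis ι ℂ V :=
  Basis.mk (linearIndependent_hermitianEigVec hH b)
    ((linearIndependent_hermitianEigVec hH b).span_eq_top_of_card_eq_finrank'
      (Module.finrank_eq_card_basis b).symm).ge

/-- The basis `(vⱼ)`, pointwise. [cite: GohbergLancasterRodman2005, Thm. A.1.1] -/
@[simp]
theorem hermitianEigVecBasis_apply (j : ι) : hermitianEigVecBasis hH b j = hermitianEigVec hH b j := by
  rw [hermitianEigVecBasis, Basis.coe_mk]

/-- **Non-degeneracy forces non-zero eigenvalues**: if `λⱼ = 0` then `vⱼ ⊥ V`, so `vⱼ = 0`.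
[cite: GohbergLancasterRodman2005, §2.2 (non-degenerate = invertible `H`)] -/
theorem eigenvalues_ne_zero (hnd : ∀ x, (∀ y, H x y = 0) → x = 0) (j : ι) :
    (isHermitian_gramMatrix hH b).eigenvalues j ≠ 0 := by
  intro h0
  have hv0 : ∀ i, H (hermitianEigVec hH b i) (hermitianEigVec hH b j) = 0 := fun i => by
    rw [apply_hermitianEigVec]
    split_ifs with hij
    · subst hij
      rw [h0, Complex.ofReal_zero]
    · rfl
  have hx : ∀ x, H x (hermitianEigVec hH b j) = 0 := fun x => by
    rw [← (hermitianEigVecBasis hH b).sum_repr x, map_sum, LinearMap.sum_apply]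
    refine Finset.sum_eq_zero fun i _ => ?_
    rw [map_smulₛₗ, LinearMap.smul_apply, hermitianEigVecBasis_apply, hv0 i, smul_zero]
  have hx' : ∀ y, H (hermitianEigVec hH b j) y = 0 := fun y => by rw [← hH.eq, hx y, map_zero]
  have hne := (hermitianEigVecBasis hH b).ne_zero j
  rw [hermitianEigVecBasis_apply] at hne
  exact hne (hnd _ hx')

/-- The rescaled vectors `wⱼ = |λⱼ|^{-1/2} vⱼ`. [cite: GohbergLancasterRodman2005, §2.3 (2.3.8)] -/
def unitHermitianEigVec (j : ι) : V :=
  (((Real.sqrt |(isHermitian_gramMatrix hH b).eigenvalues j|)⁻¹ : ℝ) : ℂ) • hermitianEigVec hH b j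

/-- **`H(wᵢ, wⱼ) = ±δᵢⱼ`**, the sign being that of `λⱼ` (for `H` non-degenerate).
[cite: GohbergLancasterRodman2005, §2.3 (2.3.8)] -/
theorem apply_unitHermitianEigVec (hnd : ∀ x, (∀ y, H x y = 0) → x = 0) (i j : ι) :
    H (unitHermitianEigVec hH b i) (unitHermitianEigVec hH b j) =
      if i = j then (if 0 < (isHermitian_gramMatrix hH b).eigenvalues i then 1 else -1) else 0 := by
  rw [unitHermitianEigVec, unitHermitianEigVec, sesq_smul_left, sesq_smul_right, apply_hermitianEigVec, Complex.conj_ofReal]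
  have hne : (isHermitian_gramMatrix hH b).eigenvalues i ≠ 0 := eigenvalues_ne_zero hH b hnd i
  split_ifs with hij hpos
  · subst hij
    have hreal : (Real.sqrt |(isHermitian_gramMatrix hH b).eigenvalues i|)⁻¹ *
        ((Real.sqrt |(isHermitian_gramMatrix hH b).eigenvalues i|)⁻¹ *
          (isHermitian_gramMatrix hH b).eigenvalues i) = 1 := by
      rw [← mul_assoc, ← mul_inv, Real.mul_self_sqrt (abs_nonneg _), abs_of_pos hpos,
        inv_mul_cancel₀ hne]
    exact_mod_cast hreal
  · subst hij
    have hneg : (isHermitian_gramMatrix hH b).eigenvalues i < 0 := lt_of_le_of_ne (not_lt.1 hpos) hne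
    have hreal : (Real.sqrt |(isHermitian_gramMatrix hH b).eigenvalues i|)⁻¹ *
        ((Real.sqrt |(isHermitian_gramMatrix hH b).eigenvalues i|)⁻¹ *
          (isHermitian_gramMatrix hH b).eigenvalues i) = -1 := by
      rw [← mul_assoc, ← mul_inv, Real.mul_self_sqrt (abs_nonneg _), abs_of_neg hneg, inv_neg,
        neg_mul, inv_mul_cancel₀ hne]
    exact_mod_cast hreal
  · rw [mul_zero, mul_zero]

end Gram

/-! ### Frames from signed orthonormal bases -/

section Frame

variable {p q : ℕ}

/-- The sign pattern `+1` on `Fin p`, `-1` on `Fin q`. [cite: GohbergLancasterRodman2005, §2.3 (2.3.8)] -/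
def frameSign (s : Fin p ⊕ Fin q) : ℂ :=
  Sum.elim (fun _ => 1) (fun _ => -1) s

/-- The coordinate map `V ≅ ℂᵖ × ℂ^q` of a basis indexed by `Fin p ⊕ Fin q`. [folklore] -/
def sumBasisCoordEquiv (B : Basis (Fin p ⊕ Fin q) ℂ V) :
    V ≃ₗ[ℂ] EuclideanSpace ℂ (Fin p) × EuclideanSpace ℂ (Fin q) :=
  B.equivFun ≪≫ₗ LinearEquiv.sumArrowLequivProdArrow (Fin p) (Fin q) ℂ ℂ ≪≫ₗ
    LinearEquiv.prodCongr (WithLp.linearEquiv 2 ℂ (Fin p → ℂ)).symm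
      (WithLp.linearEquiv 2 ℂ (Fin q → ℂ)).symm

/-- First block of coordinates. [folklore] -/
theorem sumBasisCoordEquiv_fst_apply (B : Basis (Fin p ⊕ Fin q) ℂ V) (x : V) (a : Fin p) :
    (sumBasisCoordEquiv B x).1.ofLp a = B.repr x (Sum.inl a) :=
  rfl

/-- Second block of coordinates. [folklore] -/
theorem sumBasisCoordEquiv_snd_apply (B : Basis (Fin p ⊕ Fin q) ℂ V) (x : V) (c : Fin q) :
    (sumBasisCoordEquiv B x).2.ofLp c = B.repr x (Sum.inr c) :=
  rfl

/-- **A signed `H`-orthonormal basis indexed by `Fin p ⊕ Fin q` is a unitary frame**: its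
coordinate map `V ≅ ℂᵖ × ℂ^q` is an isometry onto the standard space.
[cite: GohbergLancasterRodman2005, §2.3 (2.3.8) and Thm. 2.3.2] -/
def UnitaryFrame.ofSignedBasis (B : Basis (Fin p ⊕ Fin q) ℂ V)
    (hB : ∀ s t, H (B s) (B t) = if s = t then frameSign s else 0) : UnitaryFrame H p q where
  toLinearEquiv := sumBasisCoordEquiv B
  isometry x y := by
    have hx := B.sum_repr x
    have hy := B.sum_repr y
    conv_rhs => rw [← hx, ← hy, sesq_apply_sum_smul_of_orthogonal H hB, Fintype.sum_sum_type]
    rw [stdHermitianSesqForm_apply, stdHermitianForm, EuclideanSpace.inner_eq_star_dotProduct,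
      EuclideanSpace.inner_eq_star_dotProduct]
    simp only [dotProduct, Pi.star_apply, Complex.star_def, sumBasisCoordEquiv_fst_apply,
      sumBasisCoordEquiv_snd_apply, frameSign, Sum.elim_inl, Sum.elim_inr, mul_one, mul_neg,
      Finset.sum_neg_distrib, sub_eq_add_neg]
    congr 1
    · exact Finset.sum_congr rfl fun a _ => mul_comm _ _
    · rw [neg_inj]
      exact Finset.sum_congr rfl fun c _ => mul_comm _ _

end Frame

/-! ### Existence and uniqueness of the signature -/

section Existence

variable [FiniteDimensional ℂ V]

/-- **Sylvester's law of inertia / existence of unitary frames**: a non-degenerate Hermitian form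
on a finite-dimensional complex vector space is isometric to `⟪·,·⟫_{ℂᵖ} ⊖ ⟪·,·⟫_{ℂ^q}` for some
`p + q = dim V`. [cite: GohbergLancasterRodman2005, §2.3 (2.3.8) with Thm. A.1.1]
[cite: vanGeemen1994HodgeAV, 5.4] -/
theorem exists_unitaryFrame_of_nondegenerate (hH : H.IsSymm) (hnd : ∀ x, (∀ y, H x y = 0) → x = 0) :
    ∃ p q : ℕ, p + q = finrank ℂ V ∧ Nonempty (UnitaryFrame H p q) := by
  classical
  set b := Module.finBasis ℂ V
  set μ := (isHermitian_gramMatrix hH b).eigenvalues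
  set P := {j : Fin (finrank ℂ V) // 0 < μ j}
  set N := {j : Fin (finrank ℂ V) // ¬0 < μ j}
  set p := Fintype.card P
  set q := Fintype.card N
  -- sort the indices by sign
  let σ : Fin p ⊕ Fin q ≃ Fin (finrank ℂ V) :=
    ((Fintype.equivFin P).symm.sumCongr (Fintype.equivFin N).symm).trans (Equiv.sumCompl _)
  have hσl : ∀ a : Fin p, 0 < μ (σ (Sum.inl a)) := fun a => by
    simp only [σ, Equiv.trans_apply, Equiv.sumCongr_apply, Sum.map_inl]
    exact ((Fintype.equivFin P).symm a).2
  have hσr : ∀ c : Fin q, ¬0 < μ (σ (Sum.inr c)) := fun c => by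
    simp only [σ, Equiv.trans_apply, Equiv.sumCongr_apply, Sum.map_inr]
    exact ((Fintype.equivFin N).symm c).2
  -- the signed orthonormal basis
  have hw := apply_unitHermitianEigVec hH b hnd
  have hli : LinearIndependent ℂ (unitHermitianEigVec hH b) :=
    linearIndependent_of_sesq_orthogonal H hw fun i => by split_ifs <;> norm_num
  let W : Basis (Fin (finrank ℂ V)) ℂ V := Basis.mk hli
    (hli.span_eq_top_of_card_eq_finrank' (Fintype.card_fin _)).ge
  have hW : ∀ j, W j = unitHermitianEigVec hH b j := fun j => by rw [Basis.coe_mk]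
  let B : Basis (Fin p ⊕ Fin q) ℂ V := W.reindex σ.symm
  have hB : ∀ s t, H (B s) (B t) = if s = t then frameSign s else 0 := by
    intro s t
    rw [Basis.reindex_apply, Basis.reindex_apply, Equiv.symm_symm, hW, hW, hw]
    by_cases hst : s = t
    · subst hst
      rcases s with a | c
      · have hσl' : 0 < (isHermitian_gramMatrix hH b).eigenvalues (σ (Sum.inl a)) := hσl a
        simp [hσl', frameSign]
      · have hσr' : ¬0 < (isHermitian_gramMatrix hH b).eigenvalues (σ (Sum.inr c)) := hσr c
        simp [hσr', frameSign]
    · have hσst : σ s ≠ σ t := fun h => hst (σ.injective h)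
      simp [hst, hσst]
  refine ⟨p, q, ?_, ⟨UnitaryFrame.ofSignedBasis B hB⟩⟩
  have h := Fintype.card_congr σ
  simpa using h

/-- **The signature is well defined** (inertia): two unitary frames of the same Hermitian space
have the same `(p, q)`. [cite: GohbergLancasterRodman2005, §2.3 Thm. 2.3.2] -/
theorem UnitaryFrame.signature_unique {p q p' q' : ℕ} (F : UnitaryFrame H p q)
    (F' : UnitaryFrame H p' q') : p = p' ∧ q = q' := by
  have hp : p ≤ p' := by
    have h := F'.signatureSplitting.finrank_le_of_isPosDefOn F.signatureSplitting.isPosDefOn_pos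
    rwa [F.finrank_signatureSplitting_pos, F'.finrank_signatureSplitting_pos] at h
  have hp' : p' ≤ p := by
    have h := F.signatureSplitting.finrank_le_of_isPosDefOn F'.signatureSplitting.isPosDefOn_pos
    rwa [F.finrank_signatureSplitting_pos, F'.finrank_signatureSplitting_pos] at h
  have hpp : p = p' := le_antisymm hp hp'
  have h1 := F.signatureSplitting.finrank_pos_add_finrank_neg
  have h2 := F'.signatureSplitting.finrank_pos_add_finrank_neg
  rw [F.finrank_signatureSplitting_pos] at h1
  rw [F'.finrank_signatureSplitting_pos] at h2
  have hq : finrank ℂ F.signatureSplitting.neg = q := by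
    have h := LinearEquiv.finrank_map_eq F.toLinearEquiv.symm (stdSignatureSplitting p q).neg
    rw [← Submodule.comap_equiv_eq_map_symm] at h
    change finrank ℂ F.signatureSplitting.neg = _ at h
    rw [h, show (stdSignatureSplitting p q).neg = LinearMap.range (LinearMap.inr ℂ _ _) from rfl,
      LinearMap.finrank_range_of_inj LinearMap.inr_injective, finrank_euclideanSpace_fin]
  have hq' : finrank ℂ F'.signatureSplitting.neg = q' := by
    have h := LinearEquiv.finrank_map_eq F'.toLinearEquiv.symm (stdSignatureSplitting p' q').neg
    rw [← Submodule.comap_equiv_eq_map_symm] at h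
    change finrank ℂ F'.signatureSplitting.neg = _ at h
    rw [h, show (stdSignatureSplitting p' q').neg = LinearMap.range (LinearMap.inr ℂ _ _) from rfl,
      LinearMap.finrank_range_of_inj LinearMap.inr_injective, finrank_euclideanSpace_fin]
  refine ⟨hpp, ?_⟩
  omega

/-- **Deligne's `X⁺` is a type AIII ball for every non-degenerate Hermitian `(V, H)`**: there are
`p + q = dim V` and a bijection of the complex structures of Weil type with
`unitaryPeriodDomain p q = {Z : ℂᵖ →L ℂ^q, ‖Z‖ < 1}`; in particular `X⁺ ≠ ∅`.
[cite: Deligne1982HodgeCycles, proof of Thm. 4.8, p. 49] [cite: vanGeemen1994HodgeAV, 5.5–5.10] -/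
theorem exists_weilComplexStructureEquiv_unitaryPeriodDomain (hH : H.IsSymm)
    (hnd : ∀ x, (∀ y, H x y = 0) → x = 0) :
    ∃ p q : ℕ, p + q = finrank ℂ V ∧
      Nonempty ({J : V →ₗ[ℂ] V // IsWeilComplexStructure H J} ≃ unitaryPeriodDomain p q) := by
  obtain ⟨p, q, hpq, ⟨F⟩⟩ := exists_unitaryFrame_of_nondegenerate hH hnd
  exact ⟨p, q, hpq, ⟨F.weilComplexStructureEquiv⟩⟩

/-- A non-degenerate Hermitian space carries complex structures of Weil type (`X⁺ ≠ ∅`).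
[cite: vanGeemen1994HodgeAV, 5.5] [cite: Deligne1982HodgeCycles, proof of Thm. 4.8, p. 49] -/
theorem nonempty_weilComplexStructure_of_nondegenerate (hH : H.IsSymm)
    (hnd : ∀ x, (∀ y, H x y = 0) → x = 0) :
    Nonempty {J : V →ₗ[ℂ] V // IsWeilComplexStructure H J} := by
  obtain ⟨p, q, _, ⟨F⟩⟩ := exists_unitaryFrame_of_nondegenerate hH hnd
  exact F.nonempty_weilComplexStructure

end Existence

end Literature.AlgebraicGeometry.Motives

end
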